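import Literature.Analysis.PDE.ParabolicHolderNorm
import Mathlib.Analysis.InnerProductSpace.PiL2
import Mathlib.Topology.MetricSpace.HausdorffDistance
import HarnessLib

/-!
# White's `C^{2,α}` norm `K_{2,α}(𝓜; X)` of a flow at a point (White 2005, §2.5–2.6)

B. White, *A local regularity theorem for mean curvature flow*, Ann. of Math. 161 (2005), §2.5
(pp. 1493–4): "We wish to define a kind of local `C^{2,α}` norm of a smooth flow at a point `X ∈ 𝓜`.
This norm will be denoted `K_{2,α}(𝓜, X)`. Actually the definition below makes sense for any
subset `𝓜` of spacetime. Let `B^N = B^N(0, 1)` and `B^{N,1} = B^N × (-1, 1)` denote the open unit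
balls centered at the origin in `R^N` and in spacetime `R^{N,1}`, respectively. The graph of a
function `u : B^{m,1} → R^{N-m}` is the set `graph(u) = {(x, u(x,t), t) : (x, t) ∈ B^{m,1}}`. Now
consider first the case `X = 0 ∈ 𝓜`. Suppose we can rotate `𝓜` to get a new set `𝓜′` for which
the intersection `𝓜′ ∩ B^{N,1}` is contained in the graph of a function `u : B^{m,1} → R^{N-m}`
whose parabolic `C^{2,α}` norm is `≤ 1`. Then we will say that `K_{2,α}(𝓜, 0) ≤ 1`. … More
generally, we let `K_{2,α}(𝓜, 0) = inf{λ > 0 : K_{2,α}(D_λ 𝓜, 0) ≤ 1}`. Finally, if `X` is any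
point in `𝓜`, we let `K_{2,α}(𝓜, X) = K_{2,α}(𝓜 - X, 0)`."  §2.6 (p. 1495): "`K_{2,α}(D_λ 𝓜, D_λ X)
= λ⁻¹ K_{2,α}(𝓜, X)`. … Let `d(X, U) = inf{‖X - Y‖ : Y ∈ U^c}`. … Definition. Suppose `𝓜` is a
proper smooth flow in `U`. Then `K_{2,α;U}(𝓜) = sup_{X ∈ 𝓜} d(X, U) · K_{2,α}(𝓜, X)`. Of course
`K_{2,α;U}(𝓜)` is scale-invariant."

This file renders these DEFINITIONS (no facts) on top of `Literature.Analysis.PDE.Parabolic`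
(parabolic metric, dilations, `c2αNormOn`), for subsets of the parabolic spacetime over
`R^N = EuclideanSpace ℝ (Fin N)` and graphs of spatial dimension `m`:

* `ParabolicFlow.parabolicGraph L u D` — White's `graph(u)` after the rotation taking `R^m × 0`
  to the range of the linear isometry `L : R^m → R^N` (`u ⊥ range L` pointwise);
* `ParabolicFlow.HasUnitGraphBound m α 𝓜` — "`K_{2,α}(𝓜, 0) ≤ 1`" (the unit balls of the
  parabolic metric ARE `B^{N,1}`, `B^{m,1}`); `.mono`;
* `ParabolicFlow.k2α m α 𝓜 X : ℝ≥0∞` — `K_{2,α}(𝓜, X)` (`= ∞` when no dilate is a unit graph),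
  with `k2α_le`, `le_k2α_iff`, `k2α_eq_k2α_sub_zero` (White's reduction to `X = 0`), `k2α_mono`,
  translation invariance `k2α_image_add_right` and the SCALING LAW `k2α_image_dilation`:
  `K_{2,α}(D_c 𝓜, D_c X) = c⁻¹ K_{2,α}(𝓜, X)` (p. 1495), proved;
* `ParabolicFlow.edistCompl X U = d(X, U) ∈ [0, ∞]` (`= ∞` for `U = R^{N,1}`, as used in the proof
  of Thm. 3.2) and `ParabolicFlow.k2αOn m α 𝓜 U = K_{2,α;U}(𝓜)`, with `k2αOn_le_iff`, the
  pointwise bound, and the proved invariances `k2αOn_image_dilation` (scale) and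
  `k2αOn_image_add_right` (translation);
* the slab `U = R^N × (t - d², t + d²)`: `edistCompl_slab` (`d(X, U) = d` at time `t`) and
  `k2α_le_of_k2αOn_slab_le` (`K_{2,α;U}(𝓜) ≤ C` gives `K_{2,α}(𝓜; X) ≤ C/d` at top time).

With this vocabulary White's Theorems 3.1/4.1 can be STATED in general form (the TODO(general
form) of `WhiteLocalRegularityCylinderFlow.lean`); the sheet form used by
`White2005_localRegularity_cylinderFlowSheet_of_sheets` is the time-slice, `C^{1,1}` shadow of
`k2α m α 𝓜 X ≤ C/d`.  The Arzelà–Ascoli theorem for `K_{2,α}` (White Thm. 2.6/8.1), Cor. 2.7 and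
Prop. 2.8 are proved in `FlowC2AlphaNormLSC.lean`; NOT here: regular/proper flows (§2.2–2.3).

## References

* [White2005] B. White, Ann. of Math. 161 (2005) 1487–1519, §2.5, §2.6 (p. 1495).
-/

noncomputable section

namespace Literature.Geometry.Riemannian

open Literature.Analysis.PDE Literature.Analysis.PDE.Parabolic Metric Set
open scoped ENNReal NNReal InnerProductSpace

namespace ParabolicFlow

variable {N m : ℕ}

/-- The **parabolic graph** of `u` over the `m`-plane `L` on the spacetime region `D`:
`{⟨L x + u ⟨x, t⟩, t⟩ : ⟨x, t⟩ ∈ D}` — White's `graph(u) = {(x, u(x,t), t) : (x, t) ∈ B^{m,1}}`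
(§2.5, p. 1493) after the rotation taking `R^m × 0` to `range L` (the values of `u` are meant to
lie in `(range L)ᗮ ≅ R^{N-m}`). [cite: White2005, §2.5] -/
def parabolicGraph (L : EuclideanSpace ℝ (Fin m) →ₗᵢ[ℝ] EuclideanSpace ℝ (Fin N))
    (u : Parabolic (EuclideanSpace ℝ (Fin m)) → EuclideanSpace ℝ (Fin N))
    (D : Set (Parabolic (EuclideanSpace ℝ (Fin m)))) : Set (Parabolic (EuclideanSpace ℝ (Fin N))) :=
  (fun X => (⟨L X.x + u X, X.t⟩ : Parabolic (EuclideanSpace ℝ (Fin N)))) '' D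

/-- Membership in a parabolic graph. [cite: White2005, §2.5] -/
theorem mem_parabolicGraph {L : EuclideanSpace ℝ (Fin m) →ₗᵢ[ℝ] EuclideanSpace ℝ (Fin N)}
    {u : Parabolic (EuclideanSpace ℝ (Fin m)) → EuclideanSpace ℝ (Fin N)}
    {D : Set (Parabolic (EuclideanSpace ℝ (Fin m)))} {Y : Parabolic (EuclideanSpace ℝ (Fin N))} :
    Y ∈ parabolicGraph L u D ↔ ∃ X ∈ D, (⟨L X.x + u X, X.t⟩ : Parabolic _) = Y := Iff.rfl

/-- **`K_{2,α}(𝓜, 0) ≤ 1`** (White 2005, §2.5, pp. 1493–4): "Suppose we can rotate `𝓜` to get a new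
set `𝓜′` for which the intersection `𝓜′ ∩ B^{N,1}` is contained in the graph of a function
`u : B^{m,1} → R^{N-m}` whose parabolic `C^{2,α}` norm is `≤ 1`. Then we will say that
`K_{2,α}(𝓜, 0) ≤ 1`."  Here `B^{N,1} = B^N × (-1, 1)` and `B^{m,1}` ARE the unit balls of the
parabolic metric (`Parabolic.dist_lt_iff`), the rotation is encoded by a linear isometry
`L : R^m → R^N` with `u ⊥ range L`, and `‖u‖_{2,α}` is `Parabolic.c2αNormOn α u (ball 0 1)`.
[cite: White2005, §2.5] -/
def HasUnitGraphBound (m : ℕ) (α : ℝ≥0) (M : Set (Parabolic (EuclideanSpace ℝ (Fin N)))) : Prop :=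
  ∃ (L : EuclideanSpace ℝ (Fin m) →ₗᵢ[ℝ] EuclideanSpace ℝ (Fin N))
    (u : Parabolic (EuclideanSpace ℝ (Fin m)) → EuclideanSpace ℝ (Fin N)),
    (∀ X η, ⟪u X, L η⟫_ℝ = 0) ∧ c2αNormOn α u (ball 0 1) ≤ 1 ∧
      M ∩ ball 0 1 ⊆ parabolicGraph L u (ball 0 1)

/-- `K_{2,α}(𝓜, 0) ≤ 1` passes to subsets. [cite: White2005, §2.5] -/
theorem HasUnitGraphBound.mono {α : ℝ≥0} {M M' : Set (Parabolic (EuclideanSpace ℝ (Fin N)))}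
    (h : HasUnitGraphBound m α M') (hM : M ⊆ M') : HasUnitGraphBound m α M := by
  obtain ⟨L, u, hu, hn, hsub⟩ := h
  exact ⟨L, u, hu, hn, (inter_subset_inter_left _ hM).trans hsub⟩

/-- **White's `C^{2,α}` norm of a set `𝓜` of spacetime at a point `X`**, `K_{2,α}(𝓜; X) ∈ [0, ∞]`
(White 2005, §2.5, p. 1494): "`K_{2,α}(𝓜, 0) = inf{λ > 0 : K_{2,α}(D_λ 𝓜, 0) ≤ 1}`. Finally, if `X`
is any point in `𝓜`, we let `K_{2,α}(𝓜, X) = K_{2,α}(𝓜 - X, 0)`, where `𝓜 - X` is the flow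
obtained from `𝓜` by translating in spacetime by `-X`."  The infimum of the empty set is `∞`
(no graphical representation at any scale); `m` is the spatial dimension of the graphs.
[cite: White2005, §2.5] -/
def k2α (m : ℕ) (α : ℝ≥0) (M : Set (Parabolic (EuclideanSpace ℝ (Fin N))))
    (X : Parabolic (EuclideanSpace ℝ (Fin N))) : ℝ≥0∞ :=
  ⨅ (c : ℝ) (_ : 0 < c) (_ : HasUnitGraphBound m α (dilation c '' ((· - X) '' M))), ENNReal.ofReal c

/-- A good dilation factor bounds `K_{2,α}`. [cite: White2005, §2.5] -/
theorem k2α_le {α : ℝ≥0} {M : Set (Parabolic (EuclideanSpace ℝ (Fin N)))}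
    {X : Parabolic (EuclideanSpace ℝ (Fin N))} {c : ℝ} (hc : 0 < c)
    (h : HasUnitGraphBound m α (dilation c '' ((· - X) '' M))) : k2α m α M X ≤ ENNReal.ofReal c :=
  (iInf_le _ c).trans ((iInf_le _ hc).trans (iInf_le _ h))

/-- Lower bounds for `K_{2,α}`: `a ≤ K_{2,α}(𝓜, X)` iff `a ≤ c` for every good factor `c`.
[cite: White2005, §2.5] -/
theorem le_k2α_iff {α : ℝ≥0} {M : Set (Parabolic (EuclideanSpace ℝ (Fin N)))}
    {X : Parabolic (EuclideanSpace ℝ (Fin N))} {a : ℝ≥0∞} :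
    a ≤ k2α m α M X ↔ ∀ c : ℝ, 0 < c →
      HasUnitGraphBound m α (dilation c '' ((· - X) '' M)) → a ≤ ENNReal.ofReal c := by
  simp only [k2α, le_iInf_iff]

/-- `K_{2,α}(𝓜, X) = K_{2,α}(𝓜 - X, 0)` (White's definition). [cite: White2005, §2.5] -/
theorem k2α_eq_k2α_sub_zero (m : ℕ) (α : ℝ≥0) (M : Set (Parabolic (EuclideanSpace ℝ (Fin N))))
    (X : Parabolic (EuclideanSpace ℝ (Fin N))) : k2α m α M X = k2α m α ((· - X) '' M) 0 := by
  simp only [k2α, sub_zero, image_id']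

/-- `K_{2,α}` is monotone in the set. [cite: White2005, §2.5] -/
theorem k2α_mono (m : ℕ) (α : ℝ≥0) {M M' : Set (Parabolic (EuclideanSpace ℝ (Fin N)))}
    (hM : M ⊆ M') (X : Parabolic (EuclideanSpace ℝ (Fin N))) : k2α m α M X ≤ k2α m α M' X := by
  refine le_k2α_iff.2 fun c hc h => k2α_le hc (h.mono ?_)
  exact image_mono (image_mono hM)

/-- **Translation invariance**: `K_{2,α}(𝓜 + Z, X + Z) = K_{2,α}(𝓜, X)`. [cite: White2005, §2.5] -/
theorem k2α_image_add_right (m : ℕ) (α : ℝ≥0) (M : Set (Parabolic (EuclideanSpace ℝ (Fin N))))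
    (X Z : Parabolic (EuclideanSpace ℝ (Fin N))) :
    k2α m α ((· + Z) '' M) (X + Z) = k2α m α M X := by
  have h : (fun Y => Y - (X + Z)) '' ((· + Z) '' M) = (· - X) '' M := by
    rw [image_image]
    congr 1
    funext Y
    abel
  simp only [k2α, h]

/-- Translating and dilating commute as White uses them: `D_c 𝓜 - D_c X = D_c (𝓜 - X)`.
[cite: White2005, §2.1] -/
theorem image_sub_image_dilation {c : ℝ} (M : Set (Parabolic (EuclideanSpace ℝ (Fin N))))
    (X : Parabolic (EuclideanSpace ℝ (Fin N))) :
    (· - dilation c X) '' (dilation c '' M) = dilation c '' ((· - X) '' M) := by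
  simp only [image_image, ← dilation_sub]

/-- Good factors of a dilated pair are rescaled good factors. [cite: White2005, §2.6 p. 1495] -/
theorem hasUnitGraphBound_dilation_iff {α : ℝ≥0} (M : Set (Parabolic (EuclideanSpace ℝ (Fin N))))
    (X : Parabolic (EuclideanSpace ℝ (Fin N))) (c c' : ℝ) :
    HasUnitGraphBound m α (dilation c' '' ((· - dilation c X) '' (dilation c '' M))) ↔
      HasUnitGraphBound m α (dilation (c' * c) '' ((· - X) '' M)) := by
  rw [image_sub_image_dilation, image_image]
  simp only [dilation_dilation]

/-- **Scaling of `K_{2,α}`** (White 2005, p. 1495): "`K_{2,α}(D_λ 𝓜, D_λ X) = λ⁻¹ K_{2,α}(𝓜, X)`" —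
`K_{2,α}` scales like the reciprocal of parabolic distance. [cite: White2005, §2.6 p. 1495] -/
theorem k2α_image_dilation (m : ℕ) (α : ℝ≥0) (M : Set (Parabolic (EuclideanSpace ℝ (Fin N))))
    (X : Parabolic (EuclideanSpace ℝ (Fin N))) {c : ℝ} (hc : 0 < c) :
    k2α m α (dilation c '' M) (dilation c X) = (ENNReal.ofReal c)⁻¹ * k2α m α M X := by
  have hc0 : ENNReal.ofReal c ≠ 0 := by simpa using hc
  have hct : ENNReal.ofReal c ≠ ∞ := ENNReal.ofReal_ne_top
  refine le_antisymm ?_ ?_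
  · -- `K(D_c 𝓜, D_c X) ≤ c⁻¹ K(𝓜, X)`: `d` good for `(𝓜, X)` makes `d / c` good for the
    -- dilated pair
    have h : ENNReal.ofReal c * k2α m α (dilation c '' M) (dilation c X) ≤ k2α m α M X := by
      refine le_k2α_iff.2 fun d hd hgood => ?_
      have hgood' : HasUnitGraphBound m α
          (dilation (d / c) '' ((· - dilation c X) '' (dilation c '' M))) := by
        rw [hasUnitGraphBound_dilation_iff, div_mul_cancel₀ d hc.ne']
        exact hgood
      calc ENNReal.ofReal c * k2α m α (dilation c '' M) (dilation c X)
          ≤ ENNReal.ofReal c * ENNReal.ofReal (d / c) := by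
            gcongr; exact k2α_le (div_pos hd hc) hgood'
        _ = ENNReal.ofReal d := by
            rw [← ENNReal.ofReal_mul hc.le, mul_div_cancel₀ d hc.ne']
    calc k2α m α (dilation c '' M) (dilation c X)
        = (ENNReal.ofReal c)⁻¹ * (ENNReal.ofReal c * k2α m α (dilation c '' M) (dilation c X)) := by
          rw [ENNReal.inv_mul_cancel_left hc0 hct]
      _ ≤ (ENNReal.ofReal c)⁻¹ * k2α m α M X := by gcongr
  · -- `c⁻¹ K(𝓜, X) ≤ K(D_c 𝓜, D_c X)`: `c'` good for the dilated pair makes `c' c` good for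
    -- `(𝓜, X)`
    refine le_k2α_iff.2 fun c' hc' hgood => ?_
    rw [hasUnitGraphBound_dilation_iff] at hgood
    calc (ENNReal.ofReal c)⁻¹ * k2α m α M X
        ≤ (ENNReal.ofReal c)⁻¹ * ENNReal.ofReal (c' * c) := by
          gcongr; exact k2α_le (mul_pos hc' hc) hgood
      _ = ENNReal.ofReal c' := by
          rw [ENNReal.ofReal_mul hc'.le, mul_comm (ENNReal.ofReal c'), ← mul_assoc,
            ENNReal.inv_mul_cancel hc0 hct, one_mul]

/-! ### The scale-invariant norm `K_{2,α;U}` -/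

/-- **Parabolic distance to the complement**, `d(X, U) = inf{‖X - Y‖ : Y ∉ U} ∈ [0, ∞]`
(White 2005, §2.6, p. 1495; `= ∞` when `U` is all of spacetime, as used in the proof of Thm. 3.2).
[cite: White2005, §2.6 p. 1495] -/
def edistCompl (X : Parabolic (EuclideanSpace ℝ (Fin N)))
    (U : Set (Parabolic (EuclideanSpace ℝ (Fin N)))) : ℝ≥0∞ :=
  Metric.infEDist X Uᶜ

/-- `d(X, U)` unfolded. [cite: White2005, §2.6 p. 1495] -/
theorem edistCompl_eq (X : Parabolic (EuclideanSpace ℝ (Fin N)))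
    (U : Set (Parabolic (EuclideanSpace ℝ (Fin N)))) :
    edistCompl X U = Metric.infEDist X Uᶜ := rfl

/-- `d(X, R^{N,1}) = ∞`. [cite: White2005, §2.6 p. 1495] -/
@[simp] theorem edistCompl_univ (X : Parabolic (EuclideanSpace ℝ (Fin N))) :
    edistCompl X univ = ∞ := by
  simp [edistCompl, Metric.infEDist_empty]

/-- **White's scale-invariant norm** `K_{2,α;U}(𝓜) = sup_{X ∈ 𝓜} d(X, U) · K_{2,α}(𝓜, X) ∈ [0, ∞]`
(White 2005, §2.6, p. 1495, Definition).  (`ℝ≥0∞` conventions: `∞ · 0 = 0`.)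
[cite: White2005, §2.6 p. 1495] -/
def k2αOn (m : ℕ) (α : ℝ≥0) (M U : Set (Parabolic (EuclideanSpace ℝ (Fin N)))) : ℝ≥0∞ :=
  ⨆ X ∈ M, edistCompl X U * k2α m α M X

/-- The pointwise bound encoded by `K_{2,α;U}`. [cite: White2005, §2.6 p. 1495] -/
theorem edistCompl_mul_k2α_le_k2αOn (m : ℕ) (α : ℝ≥0)
    {M : Set (Parabolic (EuclideanSpace ℝ (Fin N)))}
    (U : Set (Parabolic (EuclideanSpace ℝ (Fin N)))) {X : Parabolic (EuclideanSpace ℝ (Fin N))}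
    (hX : X ∈ M) :
    edistCompl X U * k2α m α M X ≤ k2αOn m α M U :=
  le_iSup₂ (f := fun X (_ : X ∈ M) => edistCompl X U * k2α m α M X) X hX

/-- `K_{2,α;U}(𝓜) ≤ C` iff `d(X, U) K_{2,α}(𝓜, X) ≤ C` for all `X ∈ 𝓜`.
[cite: White2005, §2.6 p. 1495] -/
theorem k2αOn_le_iff (m : ℕ) (α : ℝ≥0) (M U : Set (Parabolic (EuclideanSpace ℝ (Fin N))))
    (C : ℝ≥0∞) :
    k2αOn m α M U ≤ C ↔ ∀ X ∈ M, edistCompl X U * k2α m α M X ≤ C := by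
  simp only [k2αOn, iSup₂_le_iff]

/-- Parabolic distances scale under dilations: `d(D_c X, D_c Y) = c · d(X, Y)` in `ℝ≥0∞`.
[cite: White2005, §2.1] -/
theorem edist_dilation {c : ℝ} (hc : 0 ≤ c) (X Y : Parabolic (EuclideanSpace ℝ (Fin N))) :
    edist (dilation c X) (dilation c Y) = ENNReal.ofReal c * edist X Y := by
  rw [edist_dist, edist_dist, dist_dilation hc, ENNReal.ofReal_mul hc]

/-- `d(D_c X, D_c U) = c · d(X, U)`. [cite: White2005, §2.6 p. 1495] -/
theorem edistCompl_dilation {c : ℝ} (hc : 0 < c) (X : Parabolic (EuclideanSpace ℝ (Fin N)))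
    (U : Set (Parabolic (EuclideanSpace ℝ (Fin N)))) :
    edistCompl (dilation c X) (dilation c '' U) = ENNReal.ofReal c * edistCompl X U := by
  have hbij : Function.Bijective (dilation c : Parabolic (EuclideanSpace ℝ (Fin N)) → _) :=
    (dilationEquiv hc).bijective
  have hc0 : ENNReal.ofReal c ≠ 0 := by simpa using hc
  rw [edistCompl, edistCompl, ← image_compl_eq hbij]
  simp only [Metric.infEDist, iInf_image, edist_dilation hc.le,
    ENNReal.mul_iInf_of_ne hc0 ENNReal.ofReal_ne_top]

/-- **`K_{2,α;U}` is scale invariant** (White 2005, §2.6, p. 1495: "Then of course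
`d(X, U) K_{2,α}(𝓜, X)` is scale invariant. … Of course `K_{2,α;U}(𝓜)` is scale-invariant.")
[cite: White2005, §2.6 p. 1495] -/
theorem k2αOn_image_dilation (m : ℕ) (α : ℝ≥0) (M U : Set (Parabolic (EuclideanSpace ℝ (Fin N))))
    {c : ℝ} (hc : 0 < c) : k2αOn m α (dilation c '' M) (dilation c '' U) = k2αOn m α M U := by
  have hc0 : ENNReal.ofReal c ≠ 0 := by simpa using hc
  have hct : ENNReal.ofReal c ≠ ∞ := ENNReal.ofReal_ne_top
  rw [k2αOn, k2αOn, iSup_image]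
  refine iSup_congr fun X => iSup_congr fun _ => ?_
  rw [edistCompl_dilation hc, k2α_image_dilation m α M X hc, mul_mul_mul_comm,
    ENNReal.mul_inv_cancel hc0 hct, one_mul]

/-- **Translation invariance of `K_{2,α;U}`.** [cite: White2005, §2.6 p. 1495] -/
theorem k2αOn_image_add_right (m : ℕ) (α : ℝ≥0) (M U : Set (Parabolic (EuclideanSpace ℝ (Fin N))))
    (Z : Parabolic (EuclideanSpace ℝ (Fin N))) :
    k2αOn m α ((· + Z) '' M) ((· + Z) '' U) = k2αOn m α M U := by
  rw [k2αOn, k2αOn, iSup_image]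
  refine iSup_congr fun X => iSup_congr fun _ => ?_
  rw [k2α_image_add_right]
  congr 1
  have hbij : Function.Bijective (fun Y : Parabolic (EuclideanSpace ℝ (Fin N)) => Y + Z) :=
    (Equiv.addRight Z).bijective
  rw [edistCompl, edistCompl, ← image_compl_eq hbij]
  simp only [Metric.infEDist, iInf_image, edist_dist, Parabolic.dist_add_right]

/-! ### The slab `U = R^N × (t - d², t + d²)`: `d(X, U) = d` at time `t` -/

section Slab

/-- **`d(X, U) = d` for `U = R^N × (t - d², t + d²)` and `X` at time `t`** (the parabolic distance
from `X` to the complement of the slab is realised by the point below `X` at time `t - d²`).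
[cite: White2005, §2.6 p. 1495] -/
theorem edistCompl_slab {t d : ℝ} (hd : 0 ≤ d) {X : Parabolic (EuclideanSpace ℝ (Fin N))}
    (hX : X.t = t) :
    edistCompl X {Y | Y.t ∈ Ioo (t - d ^ 2) (t + d ^ 2)} = ENNReal.ofReal d := by
  rw [edistCompl_eq]
  refine le_antisymm ?_ (Metric.le_infEDist.2 fun Y hY => ?_)
  · -- the point `(x, t - d²)` is in the complement, at parabolic distance `d`
    have hmem : (⟨X.x, t - d ^ 2⟩ : Parabolic (EuclideanSpace ℝ (Fin N))) ∈
        {Y : Parabolic (EuclideanSpace ℝ (Fin N)) | Y.t ∈ Ioo (t - d ^ 2) (t + d ^ 2)}ᶜ := by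
      simp
    refine (Metric.infEDist_le_edist_of_mem hmem).trans_eq ?_
    rw [edist_dist, Parabolic.dist_eq]
    simp only [dist_self, hX, Real.dist_eq, sub_sub_cancel, abs_pow, abs_of_nonneg hd,
      Real.sqrt_sq hd]
    rw [max_eq_right hd]
  · -- every point of the complement is at parabolic distance `≥ d`
    rw [edist_dist]
    refine ENNReal.ofReal_le_ofReal (le_trans ?_ (sqrt_dist_t_le X Y))
    rw [Real.le_sqrt hd dist_nonneg, Real.dist_eq, hX]
    simp only [mem_compl_iff, mem_setOf_eq, mem_Ioo, not_and_or, not_lt] at hY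
    rcases hY with h | h
    · rw [abs_of_nonneg (by linarith [sq_nonneg d])]; linarith
    · rw [abs_of_nonpos (by linarith [sq_nonneg d])]; linarith

/-- **From the scale-invariant bound to the pointwise bound at top time**: if
`K_{2,α;U}(𝓜) ≤ C` for the slab `U = R^N × (t - d², t + d²)` (`d > 0`), then
`K_{2,α}(𝓜; X) ≤ C / d` at every `X ∈ 𝓜` with `τ(X) = t`. [cite: White2005, §2.6 p. 1495] -/
theorem k2α_le_of_k2αOn_slab_le {α : ℝ≥0} {M : Set (Parabolic (EuclideanSpace ℝ (Fin N)))}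
    {t d C : ℝ} (hd : 0 < d)
    (hK : k2αOn m α M {Y | Y.t ∈ Ioo (t - d ^ 2) (t + d ^ 2)} ≤ ENNReal.ofReal C)
    {X : Parabolic (EuclideanSpace ℝ (Fin N))} (hXM : X ∈ M) (hX : X.t = t) :
    k2α m α M X ≤ ENNReal.ofReal (C / d) := by
  have h := (edistCompl_mul_k2α_le_k2αOn m α {Y | Y.t ∈ Ioo (t - d ^ 2) (t + d ^ 2)} hXM).trans hK
  rw [edistCompl_slab hd.le hX] at h
  have hd0 : ENNReal.ofReal d ≠ 0 := by simpa using hd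
  rw [ENNReal.ofReal_div_of_pos hd,
    ENNReal.le_div_iff_mul_le (Or.inl hd0) (Or.inl ENNReal.ofReal_ne_top), mul_comm]
  exact h

end Slab

end ParabolicFlow

end Literature.Geometry.Riemannian

end
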